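import Literature.Geometry.Lorentzian.InverseMeanCurvatureFlow
import HarnessLib

/-!
# Inverse mean curvature flow I — proofs: structural lemmas of the level-set weak formulation

Sorry-free lemmas about the objects of `InverseMeanCurvatureFlow.lean` (Huisken–Ilmanen,
J. Differential Geom. 59 (2001), §§1–3) that enter the proof of the Weak Existence Theorem 3.1
(the named fact `weak_existence` of that file) and need no measure theory beyond the congruence
of set integrals:

* locality of the slope: `gradNorm_congr_of_eventuallyEq` (`|∇u|(x)` depends only on the germ of
  `u` at `x`), hence `imcfEnergy_congr_of_eqOn` (`J_u^K(v) = J_u^K(w)` when `v = w` on an open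
  set containing `K`);
* `IsLocLipschitzOn.mono`, `IsLocLipschitzOn.continuousOn`, and the gluing lemma
  `isLocLipschitzOn_of_eqOn_of_eqOn` (a function equal to a locally Lipschitz `v` on an open
  `Ω'` and to a locally Lipschitz `u` on `Ω ∖ C`, `C ⊆ Ω'` closed, is locally Lipschitz on `Ω`);
* **restriction to open subsets**: `IsWeakSolution.mono`, `IsWeakSubsolution.mono`,
  `IsWeakSupersolution.mono` — a weak (sub/super)solution of (∗∗) on `Ω` is one on every open
  `Ω' ⊆ Ω` (a competitor on `Ω'` extends by `u` to a competitor on `Ω` with the same energy over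
  `K ⊆ Ω'`). This is used tacitly throughout Huisken–Ilmanen (e.g. §3, proof of Thm. 3.1, step 2:
  "`min(v, L)` is a weak subsolution in `U_L`"; proof of Thm. 2.2 (ii): part (i) is applied on
  `W = E_t ∖ F̄₀`);
* the initial value problem (††): `IsWeakSolutionIVP.continuous`, `.isOpen` (`E₀ = {u < 0}` is
  open), `.nonneg_of_not_mem`, `.nonpos_of_mem_closure`, and the **Dirichlet condition**
  `IsWeakSolutionIVP.eq_zero_of_mem_frontier` (`u = 0` on `∂E₀`, Huisken–Ilmanen's remark after
  (††)); likewise for `IsWeakSubsolutionIVP`; and `IsWeakSolutionIVP.isCompact_closure_setOf_lt`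
  — for a *proper* solution every `E_t = {u < t}` is precompact (the hypothesis "each `E_t` is
  precompact" of the Uniqueness Theorem 2.2 (iii), as used at the end of the proof of Thm. 3.1);
* the passage from uniqueness of the set flow `(E_t)_{t>0}` (Thm. 2.2 (iii)) to uniqueness of
  `u` on `M ∖ E₀` (the form stated in Thm. 3.1): `eqOn_compl_of_setOf_lt_eq`, and its (††) form
  `IsWeakSolutionIVP.eq_of_setOf_lt_eq`.

Nothing here discharges `weak_existence` itself, whose printed proof (elliptic regularisation,
§3; compactness and uniqueness, §2; regularity, §1) is a theory resting on BV/finite-perimeter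
calculus, the co-area formula and Hölder-space elliptic theory, none of which Mathlib has at the
pin; see the module docstring of `InverseMeanCurvatureFlow.lean`.

## References

* G. Huisken, T. Ilmanen, *The inverse mean curvature flow and the Riemannian Penrose
  inequality*, J. Differential Geom. 59 (2001) 353–437: §1 (Definition (1.5), (††) and the remark
  following it), §2 (Thm. 2.2 and its proof), §3 (Thm. 3.1 and its proof, step 2).
-/

noncomputable section

open Bundle Set Manifold TopologicalSpace Filter MeasureTheory
open scoped ContDiff Topology ENNReal Manifold Real

namespace Literature.Geometry.Lorentzian

open PseudoRiemannianMetric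

/-! ### Order-theoretic glue: set flows versus level-set functions -/

section Pure

variable {X : Type*}

/-- **From uniqueness of the set flow to uniqueness of `u` off `E₀`.** If two functions `u, u'`
have the same initial condition `E₀ = {u < 0} = {u' < 0}` and the same sublevel sets
`{u < t} = {u' < t}` for all `t > 0` (the sets `E_t` of Huisken–Ilmanen, determined by the
Uniqueness Theorem 2.2 (iii)), then `u' = u` on `M ∖ E₀` — the uniqueness clause as phrased in the
Weak Existence Theorem 3.1 ("unique on `M ∖ E₀`"). Huisken–Ilmanen 2001, end of the proof of
Thm. 3.1 ("Theorem 2.2(iii) implies that `u` is unique").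
[cite: HuiskenIlmanenIMCF2001, Thm. 3.1 proof (last paragraph) and Thm. 2.2 (iii)] -/
theorem eqOn_compl_of_setOf_lt_eq {u u' : X → ℝ} {E₀ : Set X} (hu : E₀ = {x | u x < 0})
    (hu' : E₀ = {x | u' x < 0}) (hflow : ∀ t : ℝ, 0 < t → {x | u x < t} = {x | u' x < t}) :
    ∀ x ∉ E₀, u' x = u x := by
  intro x hx
  have h0 : 0 ≤ u x := not_lt.1 fun hlt ↦ hx (hu ▸ hlt)
  have h0' : 0 ≤ u' x := not_lt.1 fun hlt ↦ hx (hu' ▸ hlt)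
  by_contra hne
  rcases lt_or_gt_of_ne hne with hlt | hgt
  · obtain ⟨t, h1, h2⟩ := exists_between hlt
    have hxt : x ∈ {y | u' y < t} := h1
    rw [← hflow t (h0'.trans_lt h1)] at hxt
    exact lt_irrefl _ (h2.trans hxt)
  · obtain ⟨t, h1, h2⟩ := exists_between hgt
    have hxt : x ∈ {y | u y < t} := h1
    rw [hflow t (h0.trans_lt h1)] at hxt
    exact lt_irrefl _ (h2.trans hxt)

/-- The sublevel sets `E_t = {u < t}` of a function are monotone in `t` (the family `(E_t)` is
nested). [folklore] -/
theorem setOf_lt_mono (u : X → ℝ) {s t : ℝ} (hst : s ≤ t) : {x | u x < s} ⊆ {x | u x < t} :=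
  fun _ hx ↦ lt_of_lt_of_le hx hst

end Pure

/-! ### Properness and the initial condition (topology only) -/

section Topology

variable {X : Type*} [TopologicalSpace X]

/-- **Proper functions have precompact sublevel sets above a precompact initial condition.** If
`u` is proper in Huisken–Ilmanen's sense (`{s ≤ u ≤ t}` compact), continuous, and `{u < 0}` is
precompact, then every `E_t = {u < t}` is precompact, since `{u < t} ⊆ {u < 0} ∪ {0 ≤ u ≤ t}`.
This supplies the hypothesis "each `E_t` is precompact" of the Uniqueness Theorem 2.2 (iii) for
the proper solutions of Thm. 3.1. Huisken–Ilmanen 2001, §3 (definition of proper, before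
Thm. 3.1) and Thm. 2.2 (iii). [cite: HuiskenIlmanenIMCF2001, §3 before Thm. 3.1 and Thm. 2.2 (iii)] -/
theorem isCompact_closure_setOf_lt_of_isProperFun {u : X → ℝ} (hp : IsProperFun u)
    (huc : Continuous u) (h0 : IsCompact (closure {x | u x < 0})) (t : ℝ) :
    IsCompact (closure {x | u x < t}) := by
  have hsub : {x | u x < t} ⊆ {x | u x < 0} ∪ u ⁻¹' Icc 0 t := by
    intro x hx
    by_cases hx0 : u x < 0
    · exact Or.inl hx0
    · exact Or.inr ⟨not_lt.1 hx0, le_of_lt hx⟩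
  have hcl : IsClosed (u ⁻¹' Icc 0 t) := isClosed_Icc.preimage huc
  refine (h0.union (hp 0 t)).of_isClosed_subset isClosed_closure ?_
  calc closure {x | u x < t} ⊆ closure ({x | u x < 0} ∪ u ⁻¹' Icc 0 t) := closure_mono hsub
    _ = closure {x | u x < 0} ∪ u ⁻¹' Icc 0 t := by rw [closure_union, hcl.closure_eq]

/-- For a continuous `u`, the set `{u < 0}` is open. [folklore] -/
theorem isOpen_setOf_lt_zero {u : X → ℝ} (huc : Continuous u) : IsOpen {x | u x < 0} :=
  isOpen_lt huc continuous_const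

/-- For a continuous `u`, `u ≤ 0` on the closure of `{u < 0}`. [folklore] -/
theorem nonpos_of_mem_closure_setOf_lt {u : X → ℝ} (huc : Continuous u) {x : X}
    (hx : x ∈ closure {y | u y < 0}) : u x ≤ 0 :=
  closure_lt_subset_le huc continuous_const hx

/-- **Dirichlet condition on the initial surface.** For a continuous `u`, `u = 0` on the
topological boundary of `E₀ = {u < 0}`: points of `∂E₀` lie in the closure (`u ≤ 0`) but not in
the open set `E₀` itself (`u ≥ 0`). This is Huisken–Ilmanen's remark that (††) "imposes the
Dirichlet boundary condition `u = 0` on `∂E₀`". Huisken–Ilmanen 2001, §1, after (††).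
[cite: HuiskenIlmanenIMCF2001, §1 remark after (††)] -/
theorem eq_zero_of_mem_frontier_setOf_lt {u : X → ℝ} (huc : Continuous u) {x : X}
    (hx : x ∈ frontier {y | u y < 0}) : u x = 0 := by
  have hle : u x ≤ 0 := nonpos_of_mem_closure_setOf_lt huc (frontier_subset_closure hx)
  have hnot : x ∉ {y | u y < 0} := by
    have h2 := hx.2
    rwa [(isOpen_setOf_lt_zero huc).interior_eq] at h2
  exact le_antisymm hle (not_lt.1 hnot)

end Topology

/-! ### Locality of the slope and of the energy -/

variable {X : Type*} [TopologicalSpace X] [ChartedSpace E3 X] [IsManifold (𝓡 3) ∞ X]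

section Slope

variable (h : ContMDiffRiemannianMetric (𝓡 3) ∞ E3 (TangentSpace (𝓡 3) : X → Type _))

/-- **The slope is local**: if `u` and `v` agree near `x` then `|∇u|(x) = |∇v|(x)` (the
differential `mfderiv` depends only on the germ). [folklore] -/
theorem gradNorm_congr_of_eventuallyEq {u v : X → ℝ} {x : X} (huv : u =ᶠ[𝓝 x] v) :
    gradNorm h u x = gradNorm h v x := by
  simp only [gradNorm, huv.mfderiv_eq]

/-- The slope is local, open-set form: if `u = v` on an open set `s` then `|∇u| = |∇v|` on `s`.
[folklore] -/
theorem gradNorm_congr_of_eqOn {u v : X → ℝ} {s : Set X} (hs : IsOpen s) (huv : EqOn u v s)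
    {x : X} (hx : x ∈ s) : gradNorm h u x = gradNorm h v x :=
  gradNorm_congr_of_eventuallyEq h (Filter.eventuallyEq_of_mem (hs.mem_nhds hx) huv)

variable [T2Space X] [LocallyCompactSpace X] [MeasurableSpace X] [BorelSpace X]

/-- **The energy `J_u^K` only sees the competitor near `K`.** If `v = w` on an open set `Ω'`
containing the compact set `K`, then `J_u^K(v) = J_u^K(w)`: the integrands
`|∇v| + v|∇u|` and `|∇w| + w|∇u|` agree pointwise on `K` (locality of the slope). No
integrability is needed (congruence of set integrals). [folklore] -/
theorem imcfEnergy_congr_of_eqOn {u v w : X → ℝ} {K Ω' : Set X} (hΩ' : IsOpen Ω')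
    (hK : IsCompact K) (hKΩ' : K ⊆ Ω') (hvw : EqOn v w Ω') :
    imcfEnergy h u K v = imcfEnergy h u K w := by
  unfold imcfEnergy
  refine setIntegral_congr_fun hK.measurableSet fun x hx ↦ ?_
  simp only [gradNorm_congr_of_eqOn h hΩ' hvw (hKΩ' hx), hvw (hKΩ' hx)]

end Slope

/-! ### Local Lipschitz continuity for the Riemannian distance -/

section Lipschitz

variable (h : ContMDiffRiemannianMetric (𝓡 3) ∞ E3 (TangentSpace (𝓡 3) : X → Type _))
  [T2Space X] [LocallyCompactSpace X]

/-- Local Lipschitz continuity (for the Riemannian distance) restricts to subsets. [folklore] -/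
theorem IsLocLipschitzOn.mono {u : X → ℝ} {Ω Ω' : Set X} (hu : IsLocLipschitzOn h u Ω)
    (hΩ : Ω' ⊆ Ω) : IsLocLipschitzOn h u Ω' := by
  letI : RiemannianBundle (fun x : X ↦ TangentSpace (𝓡 3) x) :=
    ⟨h.toContinuousRiemannianMetric.toRiemannianMetric⟩
  letI : PseudoEMetricSpace X := .ofRiemannianMetric (𝓡 3) X
  exact LocallyLipschitzOn.mono hu hΩ

/-- A function locally Lipschitz for the Riemannian distance on `Ω` is continuous on `Ω` (the
topology of Mathlib's Riemannian length metric is the manifold topology). [folklore] -/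
theorem IsLocLipschitzOn.continuousOn {u : X → ℝ} {Ω : Set X} (hu : IsLocLipschitzOn h u Ω) :
    ContinuousOn u Ω := by
  letI : RiemannianBundle (fun x : X ↦ TangentSpace (𝓡 3) x) :=
    ⟨h.toContinuousRiemannianMetric.toRiemannianMetric⟩
  letI : PseudoEMetricSpace X := .ofRiemannianMetric (𝓡 3) X
  exact LocallyLipschitzOn.continuousOn hu

/-- A function locally Lipschitz for the Riemannian distance on all of `X` is continuous.
[folklore] -/
theorem IsLocLipschitzOn.continuous {u : X → ℝ} (hu : IsLocLipschitzOn h u univ) :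
    Continuous u :=
  continuousOn_univ.1 (hu.continuousOn h)

/-- **Gluing locally Lipschitz functions.** Let `Ω'` be open and `C ⊆ Ω'` closed. If `w` agrees
on `Ω'` with a function `v` locally Lipschitz on `Ω'`, and on `Ω ∖ C` with a function `u` locally
Lipschitz on `Ω`, then `w` is locally Lipschitz on `Ω` (near points of `Ω'` use `v`; the other
points of `Ω` lie off the closed set `C`, use `u` there). This is the extension of a competitor
from `Ω'` to `Ω`. [folklore] -/
theorem isLocLipschitzOn_of_eqOn_of_eqOn {u v w : X → ℝ} {Ω Ω' C : Set X} (hΩ' : IsOpen Ω')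
    (hC : IsClosed C) (hCΩ' : C ⊆ Ω') (hu : IsLocLipschitzOn h u Ω)
    (hv : IsLocLipschitzOn h v Ω') (hwv : EqOn w v Ω') (hwu : EqOn w u (Ω \ C)) :
    IsLocLipschitzOn h w Ω := by
  letI : RiemannianBundle (fun x : X ↦ TangentSpace (𝓡 3) x) :=
    ⟨h.toContinuousRiemannianMetric.toRiemannianMetric⟩
  letI : PseudoEMetricSpace X := .ofRiemannianMetric (𝓡 3) X
  change LocallyLipschitzOn Ω w
  have hu' : LocallyLipschitzOn Ω u := hu
  have hv' : LocallyLipschitzOn Ω' v := hv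
  intro x hx
  by_cases hxΩ' : x ∈ Ω'
  · obtain ⟨K, t, ht, hK⟩ := hv' hxΩ'
    rw [hΩ'.nhdsWithin_eq hxΩ'] at ht
    refine ⟨K, t ∩ Ω', mem_nhdsWithin_of_mem_nhds (inter_mem ht (hΩ'.mem_nhds hxΩ')), ?_⟩
    intro y hy z hz
    rw [hwv hy.2, hwv hz.2]
    exact hK hy.1 hz.1
  · have hxC : x ∉ C := fun hxC ↦ hxΩ' (hCΩ' hxC)
    obtain ⟨K, t, ht, hK⟩ := hu' hx
    refine ⟨K, t ∩ (Ω ∩ Cᶜ), inter_mem ht (inter_mem self_mem_nhdsWithin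
      (mem_nhdsWithin_of_mem_nhds (hC.isOpen_compl.mem_nhds hxC))), ?_⟩
    intro y hy z hz
    rw [hwu ⟨hy.2.1, hy.2.2⟩, hwu ⟨hz.2.1, hz.2.2⟩]
    exact hK hy.1 hz.1

end Lipschitz

/-! ### Restriction of weak (sub/super)solutions to open subsets -/

section Restrict

variable (h : ContMDiffRiemannianMetric (𝓡 3) ∞ E3 (TangentSpace (𝓡 3) : X → Type _))
  [T2Space X] [LocallyCompactSpace X] [MeasurableSpace X] [BorelSpace X]

omit [MeasurableSpace X] [BorelSpace X] in
/-- **Extension of competitors.** Let `Ω' ⊆ Ω` with `Ω'` open, `u` locally Lipschitz on `Ω`, and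
`v` a competitor for `u` on `Ω'` (`{v ≠ u} ∩ Ω' ⊆ C ⊆ Ω'`, `C` compact). Then the glued function
`w = v` on `Ω'`, `w = u` off `Ω'` is a competitor for `u` on `Ω`, agrees with `v` on `Ω'`, differs
from `u` (within `Ω`) only where `v` does (within `Ω'`), and lies below/above `u` on `Ω` when `v`
does on `Ω'`. [folklore] -/
theorem IsCompetitor.exists_extend {u v : X → ℝ} {Ω Ω' : Set X} (hΩ' : IsOpen Ω') (hΩ : Ω' ⊆ Ω)
    (hu : IsLocLipschitzOn h u Ω) (hv : IsCompetitor h u Ω' v) :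
    ∃ w : X → ℝ, IsCompetitor h u Ω w ∧ EqOn w v Ω' ∧
      {x | x ∈ Ω ∧ w x ≠ u x} ⊆ {x | x ∈ Ω' ∧ v x ≠ u x} ∧
      ((∀ x ∈ Ω', v x ≤ u x) → ∀ x ∈ Ω, w x ≤ u x) ∧
      ((∀ x ∈ Ω', u x ≤ v x) → ∀ x ∈ Ω, u x ≤ w x) := by
  classical
  obtain ⟨hvlip, C, hC, hCΩ', hvC⟩ := hv
  refine ⟨Ω'.piecewise v u, ?_, Set.piecewise_eqOn Ω' v u, ?_, ?_, ?_⟩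
  · have hwv : EqOn (Ω'.piecewise v u) v Ω' := Set.piecewise_eqOn Ω' v u
    have hwc : EqOn (Ω'.piecewise v u) u Ω'ᶜ := Set.piecewise_eqOn_compl Ω' v u
    have hwu : EqOn (Ω'.piecewise v u) u (Ω \ C) := by
      intro y hy
      by_cases hyΩ' : y ∈ Ω'
      · rw [hwv hyΩ']
        by_contra hne
        exact hy.2 (hvC ⟨hyΩ', hne⟩)
      · exact hwc hyΩ'
    refine ⟨isLocLipschitzOn_of_eqOn_of_eqOn h hΩ' hC.isClosed hCΩ' hu hvlip hwv hwu, C, hC,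
      hCΩ'.trans hΩ, fun y hy ↦ ?_⟩
    by_contra hyC
    exact hy.2 (hwu ⟨hy.1, hyC⟩)
  · intro y hy
    by_cases hyΩ' : y ∈ Ω'
    · exact ⟨hyΩ', by simpa [Set.piecewise_eq_of_mem _ _ _ hyΩ'] using hy.2⟩
    · exact absurd (Set.piecewise_eq_of_notMem _ _ _ hyΩ') hy.2
  · intro hle y _
    by_cases hyΩ' : y ∈ Ω'
    · rw [Set.piecewise_eq_of_mem _ _ _ hyΩ']; exact hle y hyΩ'
    · rw [Set.piecewise_eq_of_notMem _ _ _ hyΩ']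
  · intro hle y _
    by_cases hyΩ' : y ∈ Ω'
    · rw [Set.piecewise_eq_of_mem _ _ _ hyΩ']; exact hle y hyΩ'
    · rw [Set.piecewise_eq_of_notMem _ _ _ hyΩ']

/-- **Weak solutions restrict to open subsets**: if `u` is a weak solution of (∗∗) on `Ω`
(Huisken–Ilmanen's (1.5)) and `Ω' ⊆ Ω` is open, then `u` is a weak solution on `Ω'`. A competitor
`v` on `Ω'` is extended by `u` to a competitor `w` on `Ω` (`IsCompetitor.exists_extend`); (1.5) on
`Ω` gives `J_u^K(u) ≤ J_u^K(w) = J_u^K(v)` for compact `K ⊆ Ω'` containing `{v ≠ u}` (locality of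
the energy). Used tacitly by Huisken–Ilmanen, e.g. in the proof of Thm. 2.2 (ii) (part (i) is
applied on `W = E_t ∖ F̄₀`) and of Thm. 3.1, step 2. [cite: HuiskenIlmanenIMCF2001, §1 Definition (1.5) and proof of Thm. 2.2 (ii)] -/
theorem IsWeakSolution.mono {u : X → ℝ} {Ω Ω' : Set X} (hu : IsWeakSolution h u Ω)
    (hΩ' : IsOpen Ω') (hΩ : Ω' ⊆ Ω) : IsWeakSolution h u Ω' := by
  refine ⟨hu.1.mono h hΩ, fun v hv K hK hKΩ' hvK ↦ ?_⟩
  obtain ⟨w, hw, hwv, hwu, -, -⟩ := IsCompetitor.exists_extend h hΩ' hΩ hu.1 hv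
  have key := hu.2 w hw K hK (hKΩ'.trans hΩ) (hwu.trans hvK)
  rwa [imcfEnergy_congr_of_eqOn h hΩ' hK hKΩ' hwv] at key

/-- **Weak subsolutions restrict to open subsets** (as `IsWeakSolution.mono`, keeping the
one-sided constraint `v ≤ u`, which the extension by `u` preserves). Huisken–Ilmanen 2001, §1
(1.5); used in the proof of Thm. 3.1, step 2 ("`min(v, L)` is a weak subsolution in `U_L`").
[cite: HuiskenIlmanenIMCF2001, §1 Definition (1.5) and proof of Thm. 3.1 step 2] -/
theorem IsWeakSubsolution.mono {u : X → ℝ} {Ω Ω' : Set X} (hu : IsWeakSubsolution h u Ω)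
    (hΩ' : IsOpen Ω') (hΩ : Ω' ⊆ Ω) : IsWeakSubsolution h u Ω' := by
  refine ⟨hu.1.mono h hΩ, fun v hv hle K hK hKΩ' hvK ↦ ?_⟩
  obtain ⟨w, hw, hwv, hwu, hwle, -⟩ := IsCompetitor.exists_extend h hΩ' hΩ hu.1 hv
  have key := hu.2 w hw (hwle hle) K hK (hKΩ'.trans hΩ) (hwu.trans hvK)
  rwa [imcfEnergy_congr_of_eqOn h hΩ' hK hKΩ' hwv] at key

/-- **Weak supersolutions restrict to open subsets** (as `IsWeakSolution.mono`, keeping the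
one-sided constraint `v ≥ u`). Huisken–Ilmanen 2001, §1 (1.5); cf. the proof of Thm. 2.2 (i)–(ii).
[cite: HuiskenIlmanenIMCF2001, §1 Definition (1.5) and proof of Thm. 2.2 (ii)] -/
theorem IsWeakSupersolution.mono {u : X → ℝ} {Ω Ω' : Set X} (hu : IsWeakSupersolution h u Ω)
    (hΩ' : IsOpen Ω') (hΩ : Ω' ⊆ Ω) : IsWeakSupersolution h u Ω' := by
  refine ⟨hu.1.mono h hΩ, fun v hv hle K hK hKΩ' hvK ↦ ?_⟩
  obtain ⟨w, hw, hwv, hwu, -, hwge⟩ := IsCompetitor.exists_extend h hΩ' hΩ hu.1 hv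
  have key := hu.2 w hw (hwge hle) K hK (hKΩ'.trans hΩ) (hwu.trans hvK)
  rwa [imcfEnergy_congr_of_eqOn h hΩ' hK hKΩ' hwv] at key

end Restrict

/-! ### The initial value problem (††) -/

section IVP

variable (h : ContMDiffRiemannianMetric (𝓡 3) ∞ E3 (TangentSpace (𝓡 3) : X → Type _))
  [T2Space X] [LocallyCompactSpace X] [MeasurableSpace X] [BorelSpace X]

/-- A solution of (††) is continuous on `X` (it is locally Lipschitz for the Riemannian
distance). Huisken–Ilmanen 2001, §1 (††) (`u ∈ C^{0,1}_loc(M)`). [cite: HuiskenIlmanenIMCF2001, §1 (††)] -/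
theorem IsWeakSolutionIVP.continuous {u : X → ℝ} {E₀ : Set X} (hu : IsWeakSolutionIVP h u E₀) :
    Continuous u :=
  hu.1.continuous h

/-- A subsolution of (††) is continuous on `X`. Huisken–Ilmanen 2001, §1 (††) and Thm. 3.1.
[cite: HuiskenIlmanenIMCF2001, §1 (††)] -/
theorem IsWeakSubsolutionIVP.continuous {u : X → ℝ} {E₀ : Set X}
    (hu : IsWeakSubsolutionIVP h u E₀) : Continuous u :=
  hu.1.continuous h

/-- The initial condition `E₀ = {u < 0}` of a solution of (††) is open. Huisken–Ilmanen 2001, §1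
(††) ("an open set `E₀`"). [cite: HuiskenIlmanenIMCF2001, §1 (††)] -/
theorem IsWeakSolutionIVP.isOpen {u : X → ℝ} {E₀ : Set X} (hu : IsWeakSolutionIVP h u E₀) :
    IsOpen E₀ := by
  rw [hu.2.1]
  exact isOpen_setOf_lt_zero (hu.continuous h)

/-- The initial condition `F₀ = {v < 0}` of a subsolution of (††) is open.
[cite: HuiskenIlmanenIMCF2001, §1 (††)] -/
theorem IsWeakSubsolutionIVP.isOpen {u : X → ℝ} {E₀ : Set X}
    (hu : IsWeakSubsolutionIVP h u E₀) : IsOpen E₀ := by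
  rw [hu.2.1]
  exact isOpen_setOf_lt_zero (hu.continuous h)

/-- Off the initial condition a solution of (††) is nonnegative (`E₀ = {u < 0}`).
[cite: HuiskenIlmanenIMCF2001, §1 (††)] -/
theorem IsWeakSolutionIVP.nonneg_of_not_mem {u : X → ℝ} {E₀ : Set X}
    (hu : IsWeakSolutionIVP h u E₀) {x : X} (hx : x ∉ E₀) : 0 ≤ u x :=
  not_lt.1 fun hlt ↦ hx (hu.2.1 ▸ hlt)

/-- On the initial condition a solution of (††) is negative (`E₀ = {u < 0}`).
[cite: HuiskenIlmanenIMCF2001, §1 (††)] -/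
theorem IsWeakSolutionIVP.neg_of_mem {u : X → ℝ} {E₀ : Set X}
    (hu : IsWeakSolutionIVP h u E₀) {x : X} (hx : x ∈ E₀) : u x < 0 := by
  rw [hu.2.1] at hx
  exact hx

/-- On the closure of the initial condition a solution of (††) is nonpositive (continuity).
[cite: HuiskenIlmanenIMCF2001, §1 (††)] -/
theorem IsWeakSolutionIVP.nonpos_of_mem_closure {u : X → ℝ} {E₀ : Set X}
    (hu : IsWeakSolutionIVP h u E₀) {x : X} (hx : x ∈ closure E₀) : u x ≤ 0 := by
  rw [hu.2.1] at hx
  exact nonpos_of_mem_closure_setOf_lt (hu.continuous h) hx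

/-- **Dirichlet condition `u = 0` on `∂E₀`** for solutions of (††): "This imposes the Dirichlet
boundary condition `u = 0` on `∂E₀`" (Huisken–Ilmanen 2001, §1, sentence after (††)).
[cite: HuiskenIlmanenIMCF2001, §1 remark after (††)] -/
theorem IsWeakSolutionIVP.eq_zero_of_mem_frontier {u : X → ℝ} {E₀ : Set X}
    (hu : IsWeakSolutionIVP h u E₀) {x : X} (hx : x ∈ frontier E₀) : u x = 0 := by
  rw [hu.2.1] at hx
  exact eq_zero_of_mem_frontier_setOf_lt (hu.continuous h) hx

/-- The Dirichlet condition `v = 0` on `∂F₀` for subsolutions of (††).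
[cite: HuiskenIlmanenIMCF2001, §1 remark after (††)] -/
theorem IsWeakSubsolutionIVP.eq_zero_of_mem_frontier {u : X → ℝ} {E₀ : Set X}
    (hu : IsWeakSubsolutionIVP h u E₀) {x : X} (hx : x ∈ frontier E₀) : u x = 0 := by
  rw [hu.2.1] at hx
  exact eq_zero_of_mem_frontier_setOf_lt (hu.continuous h) hx

/-- A solution of (††) solves (1.5) on every open set disjoint from the closure of `E₀`
(restriction, `IsWeakSolution.mono`). [cite: HuiskenIlmanenIMCF2001, §1 (††) and Definition (1.5)] -/
theorem IsWeakSolutionIVP.isWeakSolution_of_subset {u : X → ℝ} {E₀ Ω : Set X}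
    (hu : IsWeakSolutionIVP h u E₀) (hΩ : IsOpen Ω) (hΩE : Ω ⊆ (closure E₀)ᶜ) :
    IsWeakSolution h u Ω :=
  hu.2.2.mono h hΩ hΩE

/-- A subsolution of (††) is a weak subsolution on every open set disjoint from the closure of
its initial condition — in particular (with `Ω = (closure {v < L})ᶜ`, `L ≥ 0`) outside the larger
sublevel sets `F_L = {v < L}` used in the proof of Thm. 3.1, step 2.
[cite: HuiskenIlmanenIMCF2001, §1 (††) and proof of Thm. 3.1 step 2] -/
theorem IsWeakSubsolutionIVP.isWeakSubsolution_of_subset {u : X → ℝ} {E₀ Ω : Set X}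
    (hu : IsWeakSubsolutionIVP h u E₀) (hΩ : IsOpen Ω) (hΩE : Ω ⊆ (closure E₀)ᶜ) :
    IsWeakSubsolution h u Ω :=
  hu.2.2.mono h hΩ hΩE

/-- For `0 ≤ L`, the complement of the closure of the sublevel set `F_L = {v < L}` of a
subsolution of (††) lies outside the closure of `F₀ = {v < 0}`, so the subsolution property holds
there. [cite: HuiskenIlmanenIMCF2001, proof of Thm. 3.1 step 2] -/
theorem IsWeakSubsolutionIVP.isWeakSubsolution_compl_closure_setOf_lt {u : X → ℝ} {E₀ : Set X}
    (hu : IsWeakSubsolutionIVP h u E₀) {L : ℝ} (hL : 0 ≤ L) :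
    IsWeakSubsolution h u (closure {x | u x < L})ᶜ := by
  refine hu.isWeakSubsolution_of_subset h isClosed_closure.isOpen_compl ?_
  rw [hu.2.1]
  exact compl_subset_compl.2 (closure_mono (setOf_lt_mono u hL))

/-- **Proper solutions of (††) have precompact `E_t`.** If `u` solves (††) with a precompact
initial condition `E₀` and is proper, then every `E_t = {u < t}` is precompact — the standing
hypothesis of the Uniqueness Theorem 2.2 (ii)–(iii) under which Thm. 3.1 asserts uniqueness.
[cite: HuiskenIlmanenIMCF2001, Thm. 2.2 (iii) and Thm. 3.1] -/
theorem IsWeakSolutionIVP.isCompact_closure_setOf_lt {u : X → ℝ} {E₀ : Set X}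
    (hu : IsWeakSolutionIVP h u E₀) (hp : IsProperFun u) (hE₀ : IsCompact (closure E₀))
    (t : ℝ) : IsCompact (closure {x | u x < t}) :=
  isCompact_closure_setOf_lt_of_isProperFun hp (hu.continuous h) (hu.2.1 ▸ hE₀) t

/-- **Uniqueness on `M ∖ E₀` from uniqueness of the set flow**, (††) form: two solutions of (††)
with the same initial condition `E₀` whose flows `E_t = {u < t}`, `t > 0`, coincide agree off
`E₀`. With the Uniqueness Theorem 2.2 (iii) (at most one solution of (†) with precompact `E_t`)
and `IsWeakSolutionIVP.isCompact_closure_setOf_lt`, this is the last step of the proof of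
Thm. 3.1. [cite: HuiskenIlmanenIMCF2001, Thm. 3.1 proof (last paragraph)] -/
theorem IsWeakSolutionIVP.eq_of_setOf_lt_eq {u u' : X → ℝ} {E₀ : Set X}
    (hu : IsWeakSolutionIVP h u E₀) (hu' : IsWeakSolutionIVP h u' E₀)
    (hflow : ∀ t : ℝ, 0 < t → {x | u x < t} = {x | u' x < t}) : ∀ x ∉ E₀, u' x = u x :=
  eqOn_compl_of_setOf_lt_eq hu.2.1 hu'.2.1 hflow

end IVP

end Literature.Geometry.Lorentzian

end
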